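import Literature.Computability.QuantumComplexity.ClassicalWrapLayout
import HarnessLib

/-!
# The classical-wrap circuit family, Ib: well-formedness and wire bounds of the stages

Sequel of `ClassicalWrapLayout.lean` (data `WrapData`, register layout, stage programs of the
time-multiplexed classical wrap for `isQSolvable_classicalWrap`; Bernstein–Vazirani 1997, §8).
Every stage program is well formed (`ClOp.WF`: target not among the controls) and stays inside
its part of the register (`preOps_wf`, `preOps_lt`, `curOps_wf/lt`, `copyFresh`, `copyOps'_wf/lt`,
`postOps_wf`, `postOps_lt`, with the separation arithmetic `R4_add_le_Wtot`, `R5_le_Wtot`,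
`gzd_add_le_R5`, `JG_le_R5`), as needed to compile them with `revCompile` on `Wtot n` wires
(`ClassicalWrapCircuit.lean`).

## References

* E. Bernstein, U. Vazirani, *Quantum complexity theory*, SIAM J. Comput. 26 (1997), §8.
* M. A. Nielsen, I. L. Chuang, *Quantum Computation and Quantum Information*, CUP 2010, §3.2.5.
-/

noncomputable section

namespace Literature.Computability.QuantumComplexity

namespace ClassicalWrap

open Turing Function Cryptography Complexity Complexity.FinTM2Sim RevSim RevClean

namespace WrapData

variable (D : WrapData)

/-! ### Well-formedness and wire bounds of the stages -/

section WF

variable {D} (n : ℕ)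

/-- Wires of a shifted operation are shifted wires. [folklore] -/
theorem wiresOf_map_add {op : ClOp ℕ} {c i : ℕ} (hi : i ∈ wiresOf (op.map (· + c))) :
    ∃ i' ∈ wiresOf op, i = i' + c := by
  cases op with
  | not a =>
    simp only [ClOp.map, mem_wiresOf, ClOp.target, ClOp.controls, List.not_mem_nil, or_false] at hi
    exact ⟨a, by simp [wiresOf, ClOp.target], hi⟩
  | cnot a b =>
    simp only [ClOp.map, mem_wiresOf, ClOp.target, ClOp.controls, List.mem_singleton] at hi
    rcases hi with rfl | rfl
    · exact ⟨b, by simp [wiresOf, ClOp.target], rfl⟩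
    · exact ⟨a, by simp [wiresOf, ClOp.controls], rfl⟩
  | toffoli a b c' =>
    simp only [ClOp.map, mem_wiresOf, ClOp.target, ClOp.controls, List.mem_cons, List.not_mem_nil, or_false] at hi
    rcases hi with rfl | rfl | rfl
    · exact ⟨c', by simp [wiresOf, ClOp.target], rfl⟩
    · exact ⟨a, by simp [wiresOf, ClOp.controls], rfl⟩
    · exact ⟨b, by simp [wiresOf, ClOp.controls], rfl⟩

/-- A shifted well-formed program is well formed. [folklore] -/
theorem map_add_wf {ops : List (ClOp ℕ)} (h : ∀ op ∈ ops, op.WF) (c : ℕ) :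
    ∀ op ∈ ops.map (ClOp.map (· + c)), op.WF := by
  intro op' hop'
  obtain ⟨op, hop, rfl⟩ := List.mem_map.1 hop'
  exact (h op hop).map (add_left_injective c)

/-- Wires of a shifted clean block with empty suffix: `[c, c + width)`. [folklore] -/
theorem cleanOps_map_add_bounds {e : ℕ} {M : TM2ComputableAux Bool Bool} {n₀ c : ℕ} :
    ∀ op ∈ (cleanOps e M n₀ []).map (ClOp.map (· + c)), ∀ i ∈ wiresOf op, c ≤ i ∧ i < c + width e M n₀ := by
  intro op' hop' i hi
  obtain ⟨op, hop, rfl⟩ := List.mem_map.1 hop'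
  obtain ⟨i', hi', rfl⟩ := wiresOf_map_add hi
  have := cleanOps_lt op hop i' hi'
  simp only [List.length_nil, Nat.add_zero] at this
  omega

/-- The `h`-block is well formed. [folklore] -/
theorem hBlock_wf : ∀ op ∈ D.hBlock n, op.WF := map_add_wf cleanOps_wf _

/-- Wires of the `h`-block: `[R0, R2)`. [folklore] -/
theorem hBlock_bounds : ∀ op ∈ D.hBlock n, ∀ i ∈ wiresOf op, D.R0 n ≤ i ∧ i < D.R2 n := by
  intro op hop i hi
  have := cleanOps_map_add_bounds op hop i hi
  obtain ⟨-, -, h3, -⟩ := layout (D := D) n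
  change D.R2 n = D.R0 n + width D.eh D.Mh n at h3
  omega

/-- The `g`-block is well formed. [folklore] -/
theorem gBlock_wf : ∀ op ∈ D.gBlock n, op.WF := map_add_wf cleanOps_wf _

/-- Wires of the `g`-block: `[R4, R5)`. [folklore] -/
theorem gBlock_bounds : ∀ op ∈ D.gBlock n, ∀ i ∈ wiresOf op, D.R4 n ≤ i ∧ i < D.R5 n := by
  intro op hop i hi
  have := cleanOps_map_add_bounds op hop i hi
  obtain ⟨-, -, -, -, -, -, -, -, -, h3, -⟩ := layout (D := D) n
  change D.R5 n = D.R4 n + width D.eg D.Mg (D.Dg n) at h3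
  omega

/-- The move stage is well formed. [folklore] -/
theorem moveOps_wf : ∀ op ∈ D.moveOps n, op.WF := by
  obtain ⟨h1, h2, -⟩ := layout (D := D) n
  intro op hop
  simp only [moveOps, List.mem_append] at hop
  rcases hop with h | h
  · refine xorLayer_wf (fun a ha a' ha' hmem => ?_) op h
    simp only [List.mem_singleton] at hmem
    have := List.mem_range.1 ha
    omega
  · refine xorLayer_wf (fun a ha a' ha' hmem => ?_) op h
    simp only [List.mem_singleton] at hmem
    have := List.mem_range.1 ha'
    omega

/-- Wires of the move stage: front `< n` or copy `[R0, R0 + n)`. [folklore] -/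
theorem moveOps_bounds : ∀ op ∈ D.moveOps n, ∀ i ∈ wiresOf op, i < n ∨ (D.R0 n ≤ i ∧ i < D.R0 n + n) := by
  intro op hop i hi
  simp only [moveOps, List.mem_append] at hop
  rcases hop with h | h
  · obtain ⟨a, ha, hi⟩ := wiresOf_xorLayer h hi
    have := List.mem_range.1 ha
    rcases hi with rfl | hi
    · exact Or.inr ⟨Nat.le_add_right _ _, by omega⟩
    · simp only [List.mem_singleton] at hi; omega
  · obtain ⟨a, ha, hi⟩ := wiresOf_xorLayer h hi
    have := List.mem_range.1 ha
    rcases hi with rfl | hi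
    · exact Or.inl this
    · simp only [List.mem_singleton] at hi; right; omega

/-- The load stage is well formed. [folklore] -/
theorem loadOps_wf : ∀ op ∈ D.loadOps n, op.WF := by
  refine xorLayer_wf fun a ha a' ha' hmem => ?_
  obtain ⟨c, -, hc⟩ := List.mem_map.1 hmem
  have h1 := (resW_h_bounds n (List.mem_range.1 ha) c).1
  have h2 := List.mem_range.1 ha'
  obtain ⟨h3, h4, -, h5, -⟩ := layout (D := D) n
  omega

/-- Wires of the load stage: front `< B` or `h`-result wires. [folklore] -/
theorem loadOps_bounds : ∀ op ∈ D.loadOps n, ∀ i ∈ wiresOf op,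
    i < D.B n ∨ (D.R0 n + NN D.eh D.Mh n ≤ i ∧ i < D.R2 n) := by
  intro op hop i hi
  obtain ⟨a, ha, hi⟩ := wiresOf_xorLayer hop hi
  have ha' := List.mem_range.1 ha
  rcases hi with rfl | hi
  · exact Or.inl ha'
  · obtain ⟨c, -, rfl⟩ := List.mem_map.1 hi
    exact Or.inr (resW_h_bounds n ha' c)

/-- Wires of a flag program: emptiness wires and flags with index `≤ L`. [folklore] -/
theorem wiresOf_flagOps {ι : Type*} (emp flag : ℕ → ι) (L : ℕ) :
    ∀ op ∈ RevMux.flagOps emp flag L, ∀ i ∈ wiresOf op, ∃ j ≤ L, i = emp j ∨ i = flag j := by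
  intro op hop i hi
  simp only [RevMux.flagOps, List.mem_cons, List.mem_flatMap, List.mem_range, List.not_mem_nil, or_false] at hop
  rcases hop with rfl | ⟨l, hl, rfl | rfl | rfl⟩
  · simp only [mem_wiresOf, ClOp.target, ClOp.controls, List.mem_singleton] at hi
    rcases hi with rfl | rfl
    · exact ⟨0, Nat.zero_le _, Or.inr rfl⟩
    · exact ⟨0, Nat.zero_le _, Or.inl rfl⟩
  · simp only [mem_wiresOf, ClOp.target, ClOp.controls, List.not_mem_nil, or_false] at hi
    exact ⟨l, hl.le, Or.inl hi⟩
  · simp only [mem_wiresOf, ClOp.target, ClOp.controls, List.mem_cons, List.not_mem_nil, or_false] at hi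
    rcases hi with rfl | rfl | rfl
    · exact ⟨l + 1, hl, Or.inr rfl⟩
    · exact ⟨l + 1, hl, Or.inl rfl⟩
    · exact ⟨l, hl.le, Or.inl rfl⟩
  · simp only [mem_wiresOf, ClOp.target, ClOp.controls, List.not_mem_nil, or_false] at hi
    exact ⟨l, hl.le, Or.inl hi⟩

/-- The flag stage is well formed. [folklore] -/
theorem flagOps'_wf : ∀ op ∈ D.flagOps' n, op.WF := by
  refine RevMux.flagOps_wf_bdd _ _ (fun i hi j hj h => ?_) (fun j j' h => (resW_h_inj n h).1)
  have hB := Lsel_add_one (D := D) n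
  have := (resW_h_bounds n (show i < D.B n by omega) none).2
  omega

/-- Wires of the flag stage: `h`-result wires or flags `[R2, R3)`. [folklore] -/
theorem flagOps'_bounds : ∀ op ∈ D.flagOps' n, ∀ i ∈ wiresOf op,
    (D.R0 n + NN D.eh D.Mh n ≤ i ∧ i < D.R2 n) ∨ (D.R2 n ≤ i ∧ i < D.R3 n) := by
  intro op hop i hi
  have hB := Lsel_add_one (D := D) n
  obtain ⟨-, -, -, -, -, h6, -⟩ := layout (D := D) n
  obtain ⟨j, hj, rfl | rfl⟩ := wiresOf_flagOps _ _ _ op hop i hi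
  · exact Or.inl (resW_h_bounds n (by omega) none)
  · right; omega

/-- The zone-initialisation stage is well formed. [folklore] -/
theorem gzInit_wf : ∀ op ∈ D.gzInit n, op.WF := by
  obtain ⟨h1, h2, h3, h4, h5, h6, h7, -⟩ := layout (D := D) n
  intro op hop
  simp only [gzInit, List.mem_append, List.mem_singleton] at hop
  rcases hop with h | rfl
  · refine xorLayer_wf (fun a ha a' ha' hmem => ?_) op h
    simp only [List.mem_singleton] at hmem
    have := List.mem_range.1 ha
    omega
  · trivial

/-- Wires of the zone-initialisation stage: the `x`-copy `[R0, R0+n)` or the zone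
`[R4, R4 + 2n + 2)`. [folklore] -/
theorem gzInit_bounds : ∀ op ∈ D.gzInit n, ∀ i ∈ wiresOf op,
    (D.R0 n ≤ i ∧ i < D.R0 n + n) ∨ (D.R4 n ≤ i ∧ i < D.R4 n + (2 * n + 2)) := by
  intro op hop i hi
  simp only [gzInit, List.mem_append, List.mem_singleton] at hop
  rcases hop with h | rfl
  · obtain ⟨a, ha, hi⟩ := wiresOf_xorLayer h hi
    have := List.mem_range.1 ha
    rcases hi with rfl | hi
    · right; omega
    · simp only [List.mem_singleton] at hi; left; omega
  · simp only [mem_wiresOf, ClOp.target, ClOp.controls, List.not_mem_nil, or_false] at hi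
    right; omega

/-- **The pre-processing stage is well formed.** [folklore] -/
theorem preOps_wf : ∀ op ∈ D.preOps n, op.WF := by
  intro op hop
  simp only [preOps, List.mem_append] at hop
  rcases hop with (((h | h) | h) | h) | h
  · exact moveOps_wf n op h
  · exact hBlock_wf n op h
  · exact loadOps_wf n op h
  · exact flagOps'_wf n op h
  · exact gzInit_wf n op h

/-- **The pre-processing stage uses wires `< R4 + 2n + 2`.** [folklore] -/
theorem preOps_lt : ∀ op ∈ D.preOps n, ∀ i ∈ wiresOf op, i < D.R4 n + (2 * n + 2) := by
  obtain ⟨h1, h2, h3, h4, h5, h6, h7, -⟩ := layout (D := D) n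
  intro op hop i hi
  simp only [preOps, List.mem_append] at hop
  rcases hop with (((h | h) | h) | h) | h
  · rcases moveOps_bounds n op h i hi with h' | h' <;> omega
  · have := hBlock_bounds n op h i hi; omega
  · rcases loadOps_bounds n op h i hi with h' | h' <;> omega
  · rcases flagOps'_bounds n op h i hi with h' | h' <;> omega
  · rcases gzInit_bounds n op h i hi with h' | h' <;> omega

/-- `R4 + 2n + 2 ≤ Wtot`. [folklore] -/
theorem R4_add_le_Wtot : D.R4 n + (2 * n + 2) ≤ D.Wtot n := by
  obtain ⟨h1, h2, h3, h4, h5, h6, h7, h8, h9, h10, h11, h12, h13, h14, -⟩ := layout (D := D) n; omega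

/-- `R5 ≤ Wtot`. [folklore] -/
theorem R5_le_Wtot : D.R5 n ≤ D.Wtot n := by
  obtain ⟨-, -, -, -, -, -, -, -, -, -, -, -, -, h14, -⟩ := layout (D := D) n; omega

/-- The zone lies inside the `g`-block: `gzd + 2 bmax + 2 ≤ R5`. [folklore] -/
theorem gzd_add_le_R5 : D.gzd n + (2 * D.bmax n + 2) ≤ D.R5 n := by
  obtain ⟨h1, h2, h3, h4, h5, h6, h7, h8, h9, h10, h11, h12, -⟩ := layout (D := D) n; omega

/-- `JG ≤ R5` (the plain bits can be swapped onto the wires `0 … JG - 1`). [folklore] -/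
theorem JG_le_R5 : D.JG n ≤ D.R5 n := by
  obtain ⟨h1, h2, h3, h4, h5, h6, h7, h8, h9, h10, h11, h12, h13, -⟩ := layout (D := D) n; omega

/-- The `cur` stage is well formed. [folklore] -/
theorem curOps_wf (m : ℕ) (hm : m < D.B n) : ∀ op ∈ D.curOps n m, op.WF := by
  obtain ⟨-, -, -, -, -, h6, -⟩ := layout (D := D) n
  intro op hop
  simp only [curOps, List.mem_singleton] at hop
  subst hop
  show D.R2 n + m ≠ D.R3 n
  omega

/-- Wires of the `cur` stage: `R2 + m` and `R3`, both `< R4`. [folklore] -/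
theorem curOps_lt (m : ℕ) (hm : m < D.B n) : ∀ op ∈ D.curOps n m, ∀ i ∈ wiresOf op, i < D.R4 n := by
  obtain ⟨-, -, -, -, -, h6, h7, -⟩ := layout (D := D) n
  intro op hop i hi
  simp only [curOps, List.mem_singleton] at hop
  subst hop
  simp only [mem_wiresOf, ClOp.target, ClOp.controls, List.mem_singleton] at hi
  rcases hi with rfl | rfl <;> omega

/-- The freshness hypotheses of the copy stage hold for `b ≤ bmax`. [folklore] -/
theorem copyFresh (b : ℕ) (hb : b ≤ D.bmax n) : CopyFresh (D.R3 n) id (fun k => D.gzd n + k) b := by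
  obtain ⟨h1, h2, h3, h4, h5, h6, h7, h8, -⟩ := layout (D := D) n
  exact
    { gz_inj := fun k _ k' _ h => by simpa using h
      gz_ne_cur := fun k _ h => by omega
      gz_ne_fr := fun k _ i hi h => by simp only [id] at h; omega
      cur_ne_fr := fun i hi h => by simp only [id] at h; omega }

/-- The copy stage is well formed. [folklore] -/
theorem copyOps'_wf (b : ℕ) (hb : b ≤ D.bmax n) : ∀ op ∈ D.copyOps' n b, op.WF :=
  copyGz_wf (copyFresh n b hb)

/-- Wires of the copy stage: `cur`, front `< b`, zone; all `< R5`. [folklore] -/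
theorem copyOps'_lt (b : ℕ) (hb : b ≤ D.bmax n) : ∀ op ∈ D.copyOps' n b, ∀ i ∈ wiresOf op, i < D.R5 n := by
  have := gzd_add_le_R5 (D := D) n
  obtain ⟨h1, h2, h3, h4, h5, h6, h7, h8, -⟩ := layout (D := D) n
  intro op hop i hi
  rcases wiresOf_copyGz hop hi with rfl | ⟨j, hj, rfl⟩ | ⟨k, hk, rfl⟩
  · omega
  · omega
  · omega

/-- The decoding stage is well formed. [folklore] -/
theorem obOps_wf : ∀ op ∈ D.obOps n, op.WF := by
  refine xorLayer_wf fun a ha a' ha' hmem => ?_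
  obtain ⟨c, -, hc⟩ := List.mem_map.1 hmem
  have := (resW_g_bounds n (List.mem_range.1 ha) c).2
  omega

/-- Wires of the decoding stage. [folklore] -/
theorem obOps_bounds : ∀ op ∈ D.obOps n, ∀ i ∈ wiresOf op,
    (D.R4 n + NN D.eg D.Mg (D.Dg n) ≤ i ∧ i < D.R5 n) ∨ (D.R5 n ≤ i ∧ i < D.R5 n + D.JG n) := by
  intro op hop i hi
  obtain ⟨a, ha, hi⟩ := wiresOf_xorLayer hop hi
  have ha' := List.mem_range.1 ha
  rcases hi with rfl | hi
  · right; omega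
  · obtain ⟨c, -, rfl⟩ := List.mem_map.1 hi
    exact Or.inl (resW_g_bounds n ha' c)

/-- The swap stage is well formed. [folklore] -/
theorem swapOps'_wf : ∀ op ∈ D.swapOps' n, op.WF := by
  refine RevMux.swapOps_wf fun p hp => ?_
  obtain ⟨j, hj, rfl⟩ := List.mem_map.1 hp
  have := JG_le_R5 (D := D) n
  have := List.mem_range.1 hj
  show D.R5 n + j ≠ j
  omega

/-- Wires of the swap stage: `< JG` or `[R5, R5 + JG)`. [folklore] -/
theorem swapOps'_bounds : ∀ op ∈ D.swapOps' n, ∀ i ∈ wiresOf op, i < D.JG n ∨ (D.R5 n ≤ i ∧ i < D.R5 n + D.JG n) := by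
  intro op hop i hi
  obtain ⟨p, hp, hop⟩ := RevMux.mem_swapOps hop
  obtain ⟨j, hj, rfl⟩ := List.mem_map.1 hp
  have := List.mem_range.1 hj
  rcases hop with rfl | rfl
  · simp only [mem_wiresOf, ClOp.target, ClOp.controls, List.mem_singleton] at hi
    rcases hi with rfl | rfl
    · exact Or.inl this
    · right; omega
  · simp only [mem_wiresOf, ClOp.target, ClOp.controls, List.mem_singleton] at hi
    rcases hi with rfl | rfl
    · right; omega
    · exact Or.inl this

/-- **The post-processing stage is well formed.** [folklore] -/
theorem postOps_wf : ∀ op ∈ D.postOps n, op.WF := by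
  intro op hop
  simp only [postOps, List.mem_append] at hop
  rcases hop with (h | h) | h
  · exact gBlock_wf n op h
  · exact obOps_wf n op h
  · exact swapOps'_wf n op h

/-- **The post-processing stage uses wires `< Wtot`.** [folklore] -/
theorem postOps_lt : ∀ op ∈ D.postOps n, ∀ i ∈ wiresOf op, i < D.Wtot n := by
  obtain ⟨-, -, -, -, -, -, -, -, -, -, -, -, -, h14, -⟩ := layout (D := D) n
  have hJ := JG_le_R5 (D := D) n
  intro op hop i hi
  simp only [postOps, List.mem_append] at hop
  rcases hop with (h | h) | h
  · have := gBlock_bounds n op h i hi; omega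
  · rcases obOps_bounds n op h i hi with h' | h' <;> omega
  · rcases swapOps'_bounds n op h i hi with h' | h' <;> omega

end WF

end WrapData

end ClassicalWrap

end Literature.Computability.QuantumComplexity
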